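import Summits.CriticalPhenomena.PercolationContinuityZ3.Theorems.PercNearOneGluingNoHeavyLowerTailFKPhiMonotoneSharpness
import HarnessLib

/-!
# REFUTATION of the MEASURE-LEVEL one-copy containment row IN(v): an exact seven-vertex counterexample
# (PAPER-2 track (ii), refinements of the fibrewise hard-core Harris programme)

builds on p205010 (kernel theorem, internal audit signed; external expert review pending).  Support file (`--supports
stmt-CriticalPhenomena-4575`), lane `prim-facecert` (gen 16), answering LEAD-GEN106 NEXT SEAT (3) of `prim-nh-lead-4575`
("measure-level IN(v)/X: proof or exact counterexample") for the containment row; evidence `CONTAIN-MEASURE-CEX.md` on stmt-4575.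
Every number below is an exact rational decided by the KERNEL (`decide +kernel`; no `native_decide`); no definitions of mathematical
content (only Boolean event predicates on the `2¹⁰` configurations of the listed pairs and a cheap mass function), no named facts, no sorries.

THE ROW.  Two independent copies `ω₀, ω₁ ~ μ = prodBernoulli w`, a source set `S`, a target set `T`, `U = {S ↔ T}`, increasing cluster
events `A = {P(C_S)}`, `B = {Q(C_S)}` (`C_S = ⋃_{s ∈ S} C_s` the open edge cluster), `∇a = 1_A(ω₀) − 1_A(ω₁)`.  The lead's containment row
at measure level (LEAD-GEN106 §2(1), "`K₂ + K₁/2`"; lane memo FINDING-gen15 §0) is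
  `IN := E⊗E[1_U(ω₀) ∇a ∇b] = μ(A∩B∩U) + μ(U)·μ(A∩B) − μ(A∩U)·μ(B) − μ(B∩U)·μ(A) ≥ 0`,
the mirror image of the one-copy REPULSION row `μ(A∩D)μ(B) + μ(B∩D)μ(A) ≤ μ(A∩B∩D) + μ(D)μ(A∩B)` (`D = Uᶜ`), which IS a theorem
(`Consts.oneCopyRepel_measure`, p336667; fibrewise `Consts.oneCopyRepelBHK_holds`, p338298).  Its FIBREWISE form `Consts.OneCopyContainBHK` was
refuted at `n = 7` by the lead (`Consts.not_oneCopyContainBHK`); the measure-level form survived every census through `n = 7` (gen 15: no law-level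
certificate exists either — pseudo-law `E*`).
THE WITNESS (this seat): the lead's own graph `G₇ = {03, 04, 13, 15, 24, 25, 35, 45, 16, 56}` on `Fin 7` with the weights (twentieths)
`w03 = w04 = 1/20, w13 = 1/10, w15 = 9/10, w24 = 1/20, w25 = 19/20, w35 = 17/20, w45 = 19/20, w16 = 3/20, w56 = 19/20`, `S = {5}`, `T = {0}`,
`P = [2 ∈ V(C)]`, `Q = [6 ∈ V(C)]`.  With every probability an integer over `20¹⁰ = 10240000000000`:
`μ(ABU) = 828245757204`, `μ(AU) = 865615137732`, `μ(BU) = 869546588976`, `μ(U) = 908779407804`, `μ(AB) = 9331156776300`,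
`μ(A) = 9752322763884`, `μ(B) = 9797773074284` (all `/20¹⁰`), and
  `IN·20²⁰ = −30398870381472 < 0`   (`IN = −2.899·10⁻¹³`; `Consts.ContainMeasureCex.oneCopyContain_measure_lt`).
MECHANISM (lane memo FINDING-gen16): `G₇ − {5, 0}` splits into the branches `{4, 2}` and `{3, 1, 6}`; with `v = 0` joined to the two
"gate" vertices `4, 3` by edges of weight `ε`, the first order in `ε` of IN vanishes identically and
`IN/ε² → −Cov_X·Cov_Y + λ_Y·Cov_X + λ_X·Cov_Y` (`Cov` = covariance of gate and event inside a branch, `λ` = the LEAK probability that seeding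
the gate from outside flips the event), negative iff `λ_X/Cov_X + λ_Y/Cov_Y < 1` — here `0.51 + 0.34`.  All connected graphs on `≤ 6`
vertices are clean for point events (exact re-check of a bounded-weight search), so `n = 7` is the threshold.
METHOD: the kernel-arithmetic bridge `FK.RCEval` (`…LowerTailFKExactEval.lean`) at cluster weight `q = 1` (`rcMeasureW w 1 ∅ = prodBernoulli w`)
turns each measure into a `1024`-term sum of products of ten rationals, the events being read by `FK.RCEval.reachB` (`reachB_iff`) and
`FK.exists_mem_openEdgeCluster_iff` (pattern of `…ConstsThreeSepNegative.lean`).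
CLASSIFICATION: refuted-substantive (house conjecture; the load-bearing claim "conditioning ONE copy on `S ↔ v` keeps the two-copy Harris form
non-negative after averaging over fibres" is false at measure level as well; no cheap repair — the sign is decided at second order by a
graph-dependent constant taking both signs; the companion cross-reach row `K₁ ≥ 0` falls with it by the pendant identity
`X_G(v) = t·[X_{G−v}(h) + 2(1−t)K₂(h)]`, lane file `…ConstsCrossReachMeasureRefutation.lean`).
[cite: VandenbergHaggstromKahn2005, Thm. 1.3 (p. 6) with Remark 1 after Thm. 1.2 (p. 5)] [cite: Grimmett2006, §1.4 eq. (1.20) (p. 15)]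
-/

namespace Summit.CriticalPhenomena.PercolationContinuityZ3.Theorems

namespace Consts

open MeasureTheory Literature.Probability.LatticeModels Literature.Probability.Percolation

namespace ContainMeasureCex

/-- The witness as listed data: `G₇` on `Fin 7`, pairs `03, 04, 13, 15, 24, 25, 35, 45, 16, 56` with weights
`1/20, 1/20, 1/10, 9/10, 1/20, 19/20, 17/20, 19/20, 3/20, 19/20`, cluster weight `q = 1`. (this seat, gen 16) -/
abbrev G : FK.RCEval := ⟨7, 10, ![0, 0, 1, 1, 2, 2, 3, 4, 1, 5], ![3, 4, 3, 5, 4, 5, 5, 5, 6, 6],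
  ![1 / 20, 1 / 20, 1 / 10, 9 / 10, 1 / 20, 19 / 20, 17 / 20, 19 / 20, 3 / 20, 19 / 20], 1⟩

/-- The listing is valid. [folklore] -/
theorem G_valid : G.Valid := by decide +kernel

/-! ### Cheap masses (`q = 1`: no cluster count) and the event predicates by open walks -/

/-- `Σ_t [P t] · ∏_i (c_i or 1 − c_i)` — the mass of a predicate under the product weights (computable, no cluster count). [folklore] -/
def massW (P : Finset (Fin 10) → Bool) : ℚ := ∑ t : Finset (Fin 10), if P t then G.wQ t else 0

/-- At `q = 1`, `massQ = massW`. [folklore] -/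
theorem massQ_eq_massW (P : Finset (Fin 10) → Bool) : G.massQ P = massW P := by
  unfold FK.RCEval.massQ massW FK.RCEval.mQ
  refine Finset.sum_congr rfl fun t _ => ?_
  have hq : G.q = 1 := rfl
  rw [hq, one_pow, mul_one]

/-- At `q = 1`, `ZQ = Σ_t wQ t`. [folklore] -/
theorem zq_eq : G.ZQ = massW (fun _ => true) := by
  unfold FK.RCEval.ZQ massW FK.RCEval.mQ
  refine Finset.sum_congr rfl fun t _ => ?_
  have hq : G.q = 1 := rfl
  rw [hq, one_pow, mul_one, if_pos rfl]

/-- `U = {5 ↔ 0}` by open walks. -/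
def pU (t : Finset (Fin 10)) : Bool := G.reachB t 5 0
/-- `A = {5 ↔ 2}`. -/
def pA (t : Finset (Fin 10)) : Bool := G.reachB t 5 2
/-- `B = {5 ↔ 6}`. -/
def pB (t : Finset (Fin 10)) : Bool := G.reachB t 5 6
/-- `A ∩ B`. -/
def pAB (t : Finset (Fin 10)) : Bool := G.reachB t 5 2 && G.reachB t 5 6
/-- `A ∩ U`. -/
def pAU (t : Finset (Fin 10)) : Bool := G.reachB t 5 2 && G.reachB t 5 0
/-- `B ∩ U`. -/
def pBU (t : Finset (Fin 10)) : Bool := G.reachB t 5 6 && G.reachB t 5 0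
/-- `A ∩ B ∩ U`. -/
def pABU (t : Finset (Fin 10)) : Bool := (G.reachB t 5 2 && G.reachB t 5 6) && G.reachB t 5 0

/-! ### Kernel arithmetic (`decide +kernel`, `2¹⁰` configurations each: open walks and products of ten rationals) -/

set_option maxHeartbeats 0 in
/-- `Z = 1`. [folklore] -/
theorem massW_true : massW (fun _ => true) = 1 := by decide +kernel
set_option maxHeartbeats 0 in
/-- mass of `U`. (this seat, gen 16; three independent exact engines agree) -/
theorem mass_U : massW pU = 908779407804 / 10240000000000 := by decide +kernel
set_option maxHeartbeats 0 in
/-- mass of `A`. -/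
theorem mass_A : massW pA = 9752322763884 / 10240000000000 := by decide +kernel
set_option maxHeartbeats 0 in
/-- mass of `B`. -/
theorem mass_B : massW pB = 9797773074284 / 10240000000000 := by decide +kernel
set_option maxHeartbeats 0 in
/-- mass of `A ∩ B`. -/
theorem mass_AB : massW pAB = 9331156776300 / 10240000000000 := by decide +kernel
set_option maxHeartbeats 0 in
/-- mass of `A ∩ U`. -/
theorem mass_AU : massW pAU = 865615137732 / 10240000000000 := by decide +kernel
set_option maxHeartbeats 0 in
/-- mass of `B ∩ U`. -/
theorem mass_BU : massW pBU = 869546588976 / 10240000000000 := by decide +kernel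
set_option maxHeartbeats 0 in
/-- mass of `A ∩ B ∩ U`. -/
theorem mass_ABU : massW pABU = 828245757204 / 10240000000000 := by decide +kernel

/-! ### From open walks to the events of the statement -/

/-- Reachability in the listed configuration as a Boolean. [folklore] -/
theorem reach_iff (t : Finset (Fin 10)) (a b : Fin 7) :
    (openGraph (V := Fin 7) (G.conf t)).Reachable a b ↔ G.reachB t a b = true :=
  (FK.RCEval.reachB_iff (D := G) t a b).symm

/-- Reading of `U = {∃ s ∈ {5}, ∃ t ∈ {0}, s ↔ t}`, `A = [2 ∈ V(C_{5})]`, `B = [6 ∈ V(C_{5})]` as open reachability. [folklore] -/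
theorem read7 (ω : BondConfig (Fin 7)) :
    ((∃ s ∈ ({5} : Set (Fin 7)), ∃ t ∈ ({0} : Set (Fin 7)), (openGraph ω).Reachable s t) ↔ (openGraph ω).Reachable 5 0) ∧
      ((∃ e ∈ ⋃ s ∈ ({5} : Set (Fin 7)), openEdgeCluster ω s, (2 : Fin 7) ∈ e) ↔ (openGraph ω).Reachable 5 2) ∧
      ((∃ e ∈ ⋃ s ∈ ({5} : Set (Fin 7)), openEdgeCluster ω s, (6 : Fin 7) ∈ e) ↔ (openGraph ω).Reachable 5 6) := by
  have h25 : (2 : Fin 7) ≠ 5 := by decide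
  have h65 : (6 : Fin 7) ≠ 5 := by decide
  refine ⟨?_, ?_, ?_⟩
  · simp only [Set.mem_singleton_iff, exists_eq_left]
  · rw [Set.biUnion_singleton]; exact FK.exists_mem_openEdgeCluster_iff ω h25
  · rw [Set.biUnion_singleton]; exact FK.exists_mem_openEdgeCluster_iff ω h65

/-- Membership in `U`. -/
theorem mem_U (t : Finset (Fin 10)) :
    G.conf t ∈ {ω : BondConfig (Fin 7) | ∃ s ∈ ({5} : Set (Fin 7)), ∃ t ∈ ({0} : Set (Fin 7)), (openGraph ω).Reachable s t} ↔
      pU t = true := by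
  rw [Set.mem_setOf_eq, (read7 _).1, reach_iff]; rfl

/-- Membership in `A`. -/
theorem mem_A (t : Finset (Fin 10)) :
    G.conf t ∈ {ω : BondConfig (Fin 7) | ∃ e ∈ ⋃ s ∈ ({5} : Set (Fin 7)), openEdgeCluster ω s, (2 : Fin 7) ∈ e} ↔ pA t = true := by
  rw [Set.mem_setOf_eq, (read7 _).2.1, reach_iff]; rfl

/-- Membership in `B`. -/
theorem mem_B (t : Finset (Fin 10)) :
    G.conf t ∈ {ω : BondConfig (Fin 7) | ∃ e ∈ ⋃ s ∈ ({5} : Set (Fin 7)), openEdgeCluster ω s, (6 : Fin 7) ∈ e} ↔ pB t = true := by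
  rw [Set.mem_setOf_eq, (read7 _).2.2, reach_iff]; rfl

/-- Membership in `A ∩ B`. -/
theorem mem_AB (t : Finset (Fin 10)) :
    G.conf t ∈ ({ω : BondConfig (Fin 7) | ∃ e ∈ ⋃ s ∈ ({5} : Set (Fin 7)), openEdgeCluster ω s, (2 : Fin 7) ∈ e} ∩
        {ω | ∃ e ∈ ⋃ s ∈ ({5} : Set (Fin 7)), openEdgeCluster ω s, (6 : Fin 7) ∈ e}) ↔ pAB t = true := by
  rw [Set.mem_inter_iff, Set.mem_setOf_eq, Set.mem_setOf_eq, (read7 _).2.1, (read7 _).2.2, reach_iff, reach_iff]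
  unfold pAB; rw [Bool.and_eq_true]

/-- Membership in `A ∩ U`. -/
theorem mem_AU (t : Finset (Fin 10)) :
    G.conf t ∈ ({ω : BondConfig (Fin 7) | ∃ e ∈ ⋃ s ∈ ({5} : Set (Fin 7)), openEdgeCluster ω s, (2 : Fin 7) ∈ e} ∩
        {ω | ∃ s ∈ ({5} : Set (Fin 7)), ∃ t ∈ ({0} : Set (Fin 7)), (openGraph ω).Reachable s t}) ↔ pAU t = true := by
  rw [Set.mem_inter_iff, Set.mem_setOf_eq, Set.mem_setOf_eq, (read7 _).2.1, (read7 _).1, reach_iff, reach_iff]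
  unfold pAU; rw [Bool.and_eq_true]

/-- Membership in `B ∩ U`. -/
theorem mem_BU (t : Finset (Fin 10)) :
    G.conf t ∈ ({ω : BondConfig (Fin 7) | ∃ e ∈ ⋃ s ∈ ({5} : Set (Fin 7)), openEdgeCluster ω s, (6 : Fin 7) ∈ e} ∩
        {ω | ∃ s ∈ ({5} : Set (Fin 7)), ∃ t ∈ ({0} : Set (Fin 7)), (openGraph ω).Reachable s t}) ↔ pBU t = true := by
  rw [Set.mem_inter_iff, Set.mem_setOf_eq, Set.mem_setOf_eq, (read7 _).2.2, (read7 _).1, reach_iff, reach_iff]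
  unfold pBU; rw [Bool.and_eq_true]

/-- Membership in `A ∩ B ∩ U`. -/
theorem mem_ABU (t : Finset (Fin 10)) :
    G.conf t ∈ ({ω : BondConfig (Fin 7) | ∃ e ∈ ⋃ s ∈ ({5} : Set (Fin 7)), openEdgeCluster ω s, (2 : Fin 7) ∈ e} ∩
        {ω | ∃ e ∈ ⋃ s ∈ ({5} : Set (Fin 7)), openEdgeCluster ω s, (6 : Fin 7) ∈ e} ∩
        {ω | ∃ s ∈ ({5} : Set (Fin 7)), ∃ t ∈ ({0} : Set (Fin 7)), (openGraph ω).Reachable s t}) ↔ pABU t = true := by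
  rw [Set.mem_inter_iff, Set.mem_inter_iff, Set.mem_setOf_eq, Set.mem_setOf_eq, Set.mem_setOf_eq, (read7 _).2.1, (read7 _).2.2,
    (read7 _).1, reach_iff, reach_iff, reach_iff]
  unfold pABU; rw [Bool.and_eq_true, Bool.and_eq_true]

/-! ### The seven measures as real numbers -/

/-- At `q = 1` the random-cluster measure of the listing is the Bernoulli product measure. [cite: Grimmett2006, §1.3] -/
theorem rc_eq : rcMeasureW G.w ((G.q : ℚ) : ℝ) ∅ = prodBernoulli G.w := by
  have : ((G.q : ℚ) : ℝ) = 1 := by norm_num [G]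
  rw [this]; exact rcMeasureW_one G.w ∅

/-- `μ(U)` at the witness, exactly. -/
theorem real_U : (prodBernoulli G.w).real
    {ω : BondConfig (Fin 7) | ∃ s ∈ ({5} : Set (Fin 7)), ∃ t ∈ ({0} : Set (Fin 7)), (openGraph ω).Reachable s t} =
      ((908779407804 / 10240000000000 : ℚ) : ℝ) := by
  have h := FK.RCEval.real_eq_massQ_div G_valid (mem_U)
  rw [rc_eq, massQ_eq_massW, mass_U, zq_eq, massW_true, div_one] at h
  exact h

/-- `μ(A)` at the witness, exactly. -/
theorem real_A : (prodBernoulli G.w).real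
    {ω : BondConfig (Fin 7) | ∃ e ∈ ⋃ s ∈ ({5} : Set (Fin 7)), openEdgeCluster ω s, (2 : Fin 7) ∈ e} =
      ((9752322763884 / 10240000000000 : ℚ) : ℝ) := by
  have h := FK.RCEval.real_eq_massQ_div G_valid (mem_A)
  rw [rc_eq, massQ_eq_massW, mass_A, zq_eq, massW_true, div_one] at h
  exact h

/-- `μ(B)` at the witness, exactly. -/
theorem real_B : (prodBernoulli G.w).real
    {ω : BondConfig (Fin 7) | ∃ e ∈ ⋃ s ∈ ({5} : Set (Fin 7)), openEdgeCluster ω s, (6 : Fin 7) ∈ e} =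
      ((9797773074284 / 10240000000000 : ℚ) : ℝ) := by
  have h := FK.RCEval.real_eq_massQ_div G_valid (mem_B)
  rw [rc_eq, massQ_eq_massW, mass_B, zq_eq, massW_true, div_one] at h
  exact h

/-- `μ(A ∩ B)` at the witness, exactly. -/
theorem real_AB : (prodBernoulli G.w).real
    ({ω : BondConfig (Fin 7) | ∃ e ∈ ⋃ s ∈ ({5} : Set (Fin 7)), openEdgeCluster ω s, (2 : Fin 7) ∈ e} ∩
        {ω | ∃ e ∈ ⋃ s ∈ ({5} : Set (Fin 7)), openEdgeCluster ω s, (6 : Fin 7) ∈ e}) =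
      ((9331156776300 / 10240000000000 : ℚ) : ℝ) := by
  have h := FK.RCEval.real_eq_massQ_div G_valid (mem_AB)
  rw [rc_eq, massQ_eq_massW, mass_AB, zq_eq, massW_true, div_one] at h
  exact h

/-- `μ(A ∩ U)` at the witness, exactly. -/
theorem real_AU : (prodBernoulli G.w).real
    ({ω : BondConfig (Fin 7) | ∃ e ∈ ⋃ s ∈ ({5} : Set (Fin 7)), openEdgeCluster ω s, (2 : Fin 7) ∈ e} ∩
        {ω | ∃ s ∈ ({5} : Set (Fin 7)), ∃ t ∈ ({0} : Set (Fin 7)), (openGraph ω).Reachable s t}) =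
      ((865615137732 / 10240000000000 : ℚ) : ℝ) := by
  have h := FK.RCEval.real_eq_massQ_div G_valid (mem_AU)
  rw [rc_eq, massQ_eq_massW, mass_AU, zq_eq, massW_true, div_one] at h
  exact h

/-- `μ(B ∩ U)` at the witness, exactly. -/
theorem real_BU : (prodBernoulli G.w).real
    ({ω : BondConfig (Fin 7) | ∃ e ∈ ⋃ s ∈ ({5} : Set (Fin 7)), openEdgeCluster ω s, (6 : Fin 7) ∈ e} ∩
        {ω | ∃ s ∈ ({5} : Set (Fin 7)), ∃ t ∈ ({0} : Set (Fin 7)), (openGraph ω).Reachable s t}) =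
      ((869546588976 / 10240000000000 : ℚ) : ℝ) := by
  have h := FK.RCEval.real_eq_massQ_div G_valid (mem_BU)
  rw [rc_eq, massQ_eq_massW, mass_BU, zq_eq, massW_true, div_one] at h
  exact h

/-- `μ(A ∩ B ∩ U)` at the witness, exactly. -/
theorem real_ABU : (prodBernoulli G.w).real
    ({ω : BondConfig (Fin 7) | ∃ e ∈ ⋃ s ∈ ({5} : Set (Fin 7)), openEdgeCluster ω s, (2 : Fin 7) ∈ e} ∩
        {ω | ∃ e ∈ ⋃ s ∈ ({5} : Set (Fin 7)), openEdgeCluster ω s, (6 : Fin 7) ∈ e} ∩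
        {ω | ∃ s ∈ ({5} : Set (Fin 7)), ∃ t ∈ ({0} : Set (Fin 7)), (openGraph ω).Reachable s t}) =
      ((828245757204 / 10240000000000 : ℚ) : ℝ) := by
  have h := FK.RCEval.real_eq_massQ_div G_valid (mem_ABU)
  rw [rc_eq, massQ_eq_massW, mass_ABU, zq_eq, massW_true, div_one] at h
  exact h

/-! ### The refutation -/

/-- **The containment row fails at the witness**: with `μ = prodBernoulli G.w`, `S = {5}`, `T = {0}`, `A = [2 ∈ V(C_S)]`, `B = [6 ∈ V(C_S)]`,
`U = {S ↔ T}`:  `μ(A∩B∩U) + μ(U)·μ(A∩B) < μ(A∩U)·μ(B) + μ(B∩U)·μ(A)` (margin `−30398870381472/20²⁰ = −2.899·10⁻¹³`), i.e.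
`E⊗E[1_U(ω₀) ∇a ∇b] < 0`. (this seat, gen 16) [cite: VandenbergHaggstromKahn2005, Thm. 1.3 (p. 6) with Remark 1 (p. 5)] -/
theorem oneCopyContain_measure_lt :
    (prodBernoulli G.w).real ({ω : BondConfig (Fin 7) | ∃ e ∈ ⋃ s ∈ ({5} : Set (Fin 7)), openEdgeCluster ω s, (2 : Fin 7) ∈ e} ∩
          {ω | ∃ e ∈ ⋃ s ∈ ({5} : Set (Fin 7)), openEdgeCluster ω s, (6 : Fin 7) ∈ e} ∩
          {ω | ∃ s ∈ ({5} : Set (Fin 7)), ∃ t ∈ ({0} : Set (Fin 7)), (openGraph ω).Reachable s t}) +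
        (prodBernoulli G.w).real {ω : BondConfig (Fin 7) | ∃ s ∈ ({5} : Set (Fin 7)), ∃ t ∈ ({0} : Set (Fin 7)), (openGraph ω).Reachable s t} *
          (prodBernoulli G.w).real ({ω : BondConfig (Fin 7) | ∃ e ∈ ⋃ s ∈ ({5} : Set (Fin 7)), openEdgeCluster ω s, (2 : Fin 7) ∈ e} ∩
            {ω | ∃ e ∈ ⋃ s ∈ ({5} : Set (Fin 7)), openEdgeCluster ω s, (6 : Fin 7) ∈ e}) <
      (prodBernoulli G.w).real ({ω : BondConfig (Fin 7) | ∃ e ∈ ⋃ s ∈ ({5} : Set (Fin 7)), openEdgeCluster ω s, (2 : Fin 7) ∈ e} ∩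
            {ω | ∃ s ∈ ({5} : Set (Fin 7)), ∃ t ∈ ({0} : Set (Fin 7)), (openGraph ω).Reachable s t}) *
          (prodBernoulli G.w).real {ω : BondConfig (Fin 7) | ∃ e ∈ ⋃ s ∈ ({5} : Set (Fin 7)), openEdgeCluster ω s, (6 : Fin 7) ∈ e} +
        (prodBernoulli G.w).real ({ω : BondConfig (Fin 7) | ∃ e ∈ ⋃ s ∈ ({5} : Set (Fin 7)), openEdgeCluster ω s, (6 : Fin 7) ∈ e} ∩
            {ω | ∃ s ∈ ({5} : Set (Fin 7)), ∃ t ∈ ({0} : Set (Fin 7)), (openGraph ω).Reachable s t}) *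
          (prodBernoulli G.w).real {ω : BondConfig (Fin 7) | ∃ e ∈ ⋃ s ∈ ({5} : Set (Fin 7)), openEdgeCluster ω s, (2 : Fin 7) ∈ e} := by
  rw [real_ABU, real_U, real_AB, real_AU, real_B, real_BU, real_A]
  norm_num

end ContainMeasureCex

/-- **THEOREM: the measure-level one-copy CONTAINMENT row is NOT a law of percolation.**  It is false that for every finite weighted
graph, source set `S`, target set `T` and increasing cluster events `A = {P(C_S)}`, `B = {Q(C_S)}`,
`μ(A∩U)·μ(B) + μ(B∩U)·μ(A) ≤ μ(A∩B∩U) + μ(U)·μ(A∩B)` with `U = {S ↔ T}` — i.e. that conditioning ONE of two independent copies on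
`S ↔ T` keeps `E[1_U(ω₀)(1_A(ω₀) − 1_A(ω₁))(1_B(ω₀) − 1_B(ω₁))] ≥ 0`; witness `Consts.ContainMeasureCex.oneCopyContain_measure_lt`
(`n = 7`, `S = {5}`, `T = {0}`, `P = [2 ∈ V(C)]`, `Q = [6 ∈ V(C)]`).  Contrast: the REPULSION row (one copy conditioned on `S ↮ T`) is the
theorem `Consts.oneCopyRepel_measure`, and all connected graphs on `≤ 6` vertices satisfy the containment row for point events.
refuted-substantive. [cite: VandenbergHaggstromKahn2005, Thm. 1.3 (p. 6) with Remark 1 after Thm. 1.2 (p. 5)] -/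
theorem not_oneCopyContain_measure : ¬ (∀ (n : ℕ) (w : Sym2 (Fin n) → unitInterval) (S T : Set (Fin n))
    (P Q : Set (Sym2 (Fin n)) → Prop), (∀ ⦃C C' : Set (Sym2 (Fin n))⦄, C ⊆ C' → P C → P C') →
    (∀ ⦃C C' : Set (Sym2 (Fin n))⦄, C ⊆ C' → Q C → Q C') →
    (prodBernoulli w).real ({ω : BondConfig (Fin n) | P (⋃ s ∈ S, openEdgeCluster ω s)} ∩
          {ω | ∃ s ∈ S, ∃ t ∈ T, (openGraph ω).Reachable s t}) *
        (prodBernoulli w).real {ω : BondConfig (Fin n) | Q (⋃ s ∈ S, openEdgeCluster ω s)} +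
      (prodBernoulli w).real ({ω : BondConfig (Fin n) | Q (⋃ s ∈ S, openEdgeCluster ω s)} ∩
          {ω | ∃ s ∈ S, ∃ t ∈ T, (openGraph ω).Reachable s t}) *
        (prodBernoulli w).real {ω : BondConfig (Fin n) | P (⋃ s ∈ S, openEdgeCluster ω s)} ≤
    (prodBernoulli w).real ({ω : BondConfig (Fin n) | P (⋃ s ∈ S, openEdgeCluster ω s)} ∩
          {ω | Q (⋃ s ∈ S, openEdgeCluster ω s)} ∩ {ω | ∃ s ∈ S, ∃ t ∈ T, (openGraph ω).Reachable s t}) +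
      (prodBernoulli w).real {ω : BondConfig (Fin n) | ∃ s ∈ S, ∃ t ∈ T, (openGraph ω).Reachable s t} *
        (prodBernoulli w).real ({ω : BondConfig (Fin n) | P (⋃ s ∈ S, openEdgeCluster ω s)} ∩
          {ω | Q (⋃ s ∈ S, openEdgeCluster ω s)})) := by
  intro h
  have h7 := h 7 ContainMeasureCex.G.w {5} {0} (fun C => ∃ e ∈ C, (2 : Fin 7) ∈ e) (fun C => ∃ e ∈ C, (6 : Fin 7) ∈ e)
    (fun _ _ hCC' ⟨e, he, h2⟩ => ⟨e, hCC' he, h2⟩) (fun _ _ hCC' ⟨e, he, h6⟩ => ⟨e, hCC' he, h6⟩)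
  exact absurd h7 (not_le.2 ContainMeasureCex.oneCopyContain_measure_lt)

end Consts

end Summit.CriticalPhenomena.PercolationContinuityZ3.Theorems
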